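/-
Copyright (c) 2026 the pub-hodgecm-mathlib formalisation cell (harness21).  Prover seat hodgecm-mathlib-K2E4-p10 (g5), Track B ∕ K2-LIT, h413 =
`stmt-HodgeConjecture-24833`, ENGINE E1, campaign «EIS-R7-BL» (Bernstein–Lapid soft continuation), deal «BL-P2» of the dealer K2E1-plan (g5) 2026-09-04T08:31:57Z, design «=»
08:41:42Z (D6-a letters-as-arguments, D7): the OPERATOR leaf over ★∕📤 `K2E1BLBorelSpacesU2Defs`.
-/
import Summits.HodgeConjecture.HodgeConjecture.Theorems.K2E1BLBorelSpacesU2Defs     -- ★∕📤 (this seat): `borelQuotient`, `HN`, `HX`, `pZX`, `rightShift`, `weightedTruncMeasure`, `supHeight`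
import HarnessLib

/-!
# K2·E1 — `K2E1BLBorelOperatorsU2Defs` (campaign «EIS-R7-BL», deal «BL-P2», defs leaf D6∕D7): THE BERNSTEIN–LAPID OPERATORS `ι_{c,k} : 𝓗_k(𝔛) → 𝓗_k(Z_c)`, `π_{c,k} : 𝓗_k(Z_c) → 𝓗_k(𝔛)`
# (`ι ∘ π = ` the orthogonal projection onto `range ι` BY CONSTRUCTION) AND THE SHIFTED HECKE OPERATOR `δ_{c,c₀}(h) = restr ∘ R(h)` — WITH THEIR REDUCTION-THEORY LETTERS AS ARGUMENTS

Track B ∕ K2-LIT, crux h413 = `stmt-HodgeConjecture-24833`, route of record `HCCMUnconditional`; cell `hodgecm-mathlib`, squad K2, ENGINE E1.  DEFINITIONS ONLY (no `instance`, no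
notation, no `sorry`); lane `--kind definition --supports stmt-HodgeConjecture-24833 --as helper` (reviewed).  Closes no socket.  GENERIC rank `N` (clone discipline).

THE MATHEMATICS [BernsteinLapid2019, §4 Claim 4 (bullets 1, 2, 5) and p. 10 last lines; Borel1963, §5; MoeglinWaldspurger1995, I.2.13].  `p_c : Z_c → 𝔛` (★ `pZX`), `ι_{c,k} f := f ∘ p_c`
restricted to `Z_c`; Bernstein–Lapid: «it follows from reduction theory that for suitable `c₀`, `ι_{c,k}` is a closed embedding for `c ≥ c₀`» — its boundedness is the Siegel covering
multiplicity bound and its well-definedness on a.e.-classes is the quasi-measure-preservation of `p_c`; BOTH are REDUCTION THEORY (★ in tree only as the hypothesis `IsCoveringWeight`, p858325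
`hβ`; K2E1-p08's BL-R1 file discharges them), so they enter as the NAMED LETTER **`IotaBound`** (an ARGUMENT of the def — dealer «=» D6-a, no junk totals).  `π_{c,k} := ι⁻¹ ∘ P_{range ι}`
from the closed-range and injectivity letters, so that `ι ∘ π = P_{range ι}` (the orthogonal projection) holds by construction (bullet 2).  `δ(h)φ(z) = ∫_G h(y) φ(z·y) dν_G(y)` (right
convolution through ★ `rightShift`) and `δ_{c,c₀}(h) := restr ∘ δ(h) : 𝓗_k(Z_c) → 𝓗_k(Z_{c₀})` — bounded when `supp h` is compact and `c₀ ≤ κ_h c` (B–L p. 10: `H(xg) > κc` for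
`x ∈ Z_c`, `g ∈ supp h`); the existence of this bounded operator with the defining a.e.-formula is the letter **`ShiftBound`** (P3 discharges it), and `deltaShift` is ITS operator
(unique by the a.e.-formula, `deltaShift_spec`).
* §1 D6 `iotaFun`, **`IotaBound`**, `memLp_iotaFun`, `iotaLin`, **`iota`** (+ `coeFn_iota`, `norm_iota_le`), **`piN`** (+ `iota_comp_piN` = orthogonal projection onto `range ι`).
* §2 D7 `rightConvFun`, **`ShiftBound`**, **`deltaShift`** (+ `deltaShift_spec`).
HONEST LABEL: HC_CM is proved only modulo the 7 printed citations (2 remaining named inputs: hLiu418 = `stmt-HodgeConjecture-24832`, h413 = `stmt-HodgeConjecture-24833`) until rung 0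
closes; this file defines objects, asserts no named fact and closes no socket; count-neutral.

## References
* [BernsteinLapid2019] J. Bernstein, E. Lapid, *On the meromorphic continuation of Eisenstein series*, arXiv:1911.02342 (J. Amer. Math. Soc. 2020): §4, Claim 4 (p. 10).
* [Borel1963] A. Borel, *Some finiteness properties of adele groups over number fields*, Publ. IHÉS 16 (1963): §5.
* [MoeglinWaldspurger1995] C. Mœglin, J.-L. Waldspurger, *Spectral Decomposition and Eisenstein Series* (1995): I.2.13.
-/

set_option autoImplicit false
set_option linter.dupNamespace false -- the mandated namespace repeats `HodgeConjecture.HodgeConjecture`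

noncomputable section

open MeasureTheory NumberField IsDedekindDomain Filter Topology
open scoped NNReal ENNReal
open Literature.NumberTheory.Automorphic Literature.NumberTheory.Automorphic.UnitaryGroup AdelicGroupData
open Summit.HodgeConjecture.HodgeConjecture.Cruxes.H413.K2E1BLBorelSpacesU2Defs

namespace Summit.HodgeConjecture.HodgeConjecture.Cruxes.H413.K2E1BLBorelOperatorsU2Defs

variable (F E : Type) [Field F] [NumberField F] [Field E] [NumberField E] [Algebra F E] (c : E ≃ₐ[F] E) (N : ℕ) [NeZero N]

/-! ## §1 (D6) `ι_{c,k}` and `π_{c,k}` -/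

section Iota

/-- The pulled-back function `f ∘ p_c : Z → ℂ` of (a representative of) `f ∈ 𝓗_k(𝔛)`. [cite: BernsteinLapid2019, §4 Claim 4 p. 10] -/
def iotaFun (k : ℕ) (μ : Measure (quasiSplit F E c N).automorphicQuotient) (f : HX F E c N k μ) : borelQuotient F E c N → ℂ :=
  fun z => (f : (quasiSplit F E c N).automorphicQuotient → ℂ) (pZX F E c N z)

/-- **THE REDUCTION-THEORY LETTER `IotaBound`** (Claim 4 bullet 1, «for suitable `c₀` … `ι_{c,N}` is a closed embedding»): (i) `p_c : (Z_c, H^{−2k}μZ) → (𝔛, w₁^{−2k}μ)` is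
quasi-measure-preserving (null sets pull back to null sets — so `ι` is well defined on a.e.-classes), and (ii) ONE constant `C` with `‖f ∘ p_c‖_{𝓗_k(Z_c)} ≤ C·‖f‖_{𝓗_k(𝔛)}` (the Siegel
covering multiplicity bound).  Discharged by the BL-R1 file (K2E1-p08) or carried as `hβ`. [cite: BernsteinLapid2019, §4 Claim 4 p. 10] [cite: Borel1963, §5] -/
def IotaBound (k : ℕ) (c₁ : ℝ≥0) (μ : Measure (quasiSplit F E c N).automorphicQuotient) (μZ : Measure (borelQuotient F E c N)) : Prop :=
  Measure.QuasiMeasurePreserving (pZX F E c N) (weightedTruncMeasure F E c N k c₁ μZ)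
      (μ.withDensity fun x => (((supHeight F E c N x)⁻¹ ^ (2 * k) : ℝ≥0) : ℝ≥0∞)) ∧
    ∃ C : ℝ≥0, ∀ f : HX F E c N k μ,
      eLpNorm (iotaFun F E c N k μ f) 2 (weightedTruncMeasure F E c N k c₁ μZ) ≤
        C * eLpNorm (f : (quasiSplit F E c N).automorphicQuotient → ℂ) 2 (μ.withDensity fun x => (((supHeight F E c N x)⁻¹ ^ (2 * k) : ℝ≥0) : ℝ≥0∞))

variable {F E c N} {k : ℕ} {c₁ : ℝ≥0} {μ : Measure (quasiSplit F E c N).automorphicQuotient} {μZ : Measure (borelQuotient F E c N)}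

/-- Under `IotaBound`, `f ∘ p_c ∈ 𝓗_k(Z_c)`. [cite: BernsteinLapid2019, §4 Claim 4 p. 10] -/
theorem memLp_iotaFun (hb : IotaBound F E c N k c₁ μ μZ) (f : HX F E c N k μ) : MemLp (iotaFun F E c N k μ f) 2 (weightedTruncMeasure F E c N k c₁ μZ) := by
  obtain ⟨hq, C, hC⟩ := hb
  refine ⟨(Lp.aestronglyMeasurable f).comp_quasiMeasurePreserving hq, lt_of_le_of_lt (hC f) ?_⟩
  exact ENNReal.mul_lt_top ENNReal.coe_lt_top (Lp.eLpNorm_lt_top f)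

/-- `(f + g) ∘ p_c =ᵐ f ∘ p_c + g ∘ p_c` on `Z_c` (quasi-measure-preservation pulls back the a.e. identity `⇑(f+g) = ⇑f + ⇑g`). [cite: BernsteinLapid2019, §4 Claim 4 p. 10] -/
theorem iotaFun_add (hb : IotaBound F E c N k c₁ μ μZ) (f g : HX F E c N k μ) :
    iotaFun F E c N k μ (f + g) =ᵐ[weightedTruncMeasure F E c N k c₁ μZ] iotaFun F E c N k μ f + iotaFun F E c N k μ g := by
  filter_upwards [hb.1.ae_eq (Lp.coeFn_add f g)] with z hz
  exact hz

/-- `(a • f) ∘ p_c =ᵐ a • (f ∘ p_c)` on `Z_c`. [cite: BernsteinLapid2019, §4 Claim 4 p. 10] -/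
theorem iotaFun_smul (hb : IotaBound F E c N k c₁ μ μZ) (a : ℂ) (f : HX F E c N k μ) :
    iotaFun F E c N k μ (a • f) =ᵐ[weightedTruncMeasure F E c N k c₁ μZ] a • iotaFun F E c N k μ f := by
  filter_upwards [hb.1.ae_eq (Lp.coeFn_smul a f)] with z hz
  exact hz

/-- **`ι_{c,k}` as a LINEAR map** (pull back a representative and take its class). [cite: BernsteinLapid2019, §4 Claim 4 p. 10] -/
def iotaLin (hb : IotaBound F E c N k c₁ μ μZ) : HX F E c N k μ →ₗ[ℂ] HN F E c N k c₁ μZ where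
  toFun f := (memLp_iotaFun hb f).toLp (iotaFun F E c N k μ f)
  map_add' f g := by
    rw [← MemLp.toLp_add (memLp_iotaFun hb f) (memLp_iotaFun hb g)]
    exact MemLp.toLp_congr _ _ (iotaFun_add hb f g)
  map_smul' a f := by
    rw [RingHom.id_apply, ← MemLp.toLp_const_smul]
    exact MemLp.toLp_congr _ _ (iotaFun_smul hb a f)

/-- Unfolding of `iotaLin`. [cite: BernsteinLapid2019, §4 Claim 4 p. 10] -/
theorem iotaLin_apply (hb : IotaBound F E c N k c₁ μ μZ) (f : HX F E c N k μ) : iotaLin hb f = (memLp_iotaFun hb f).toLp (iotaFun F E c N k μ f) := rfl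

/-- The norm bound of `ι_{c,k}`: `‖ι f‖ ≤ C‖f‖`. [cite: BernsteinLapid2019, §4 Claim 4 p. 10] [cite: Borel1963, §5] -/
theorem exists_norm_iotaLin_le (hb : IotaBound F E c N k c₁ μ μZ) : ∃ C : ℝ, ∀ f : HX F E c N k μ, ‖iotaLin hb f‖ ≤ C * ‖f‖ := by
  obtain ⟨C, hC⟩ := hb.2
  refine ⟨C, fun f => ?_⟩
  rw [iotaLin_apply, Lp.norm_toLp, Lp.norm_def, ← ENNReal.coe_toReal C, ← ENNReal.toReal_mul]
  exact ENNReal.toReal_mono (ENNReal.mul_ne_top ENNReal.coe_ne_top (Lp.eLpNorm_ne_top f)) (hC f)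

/-- **`ι_{c,k} : 𝓗_k(𝔛) →L 𝓗_k(Z_c)`** — the bounded pull-back along `p_c`, from the letter `IotaBound`. [cite: BernsteinLapid2019, §4 Claim 4 p. 10] [cite: Borel1963, §5] -/
def iota (hb : IotaBound F E c N k c₁ μ μZ) : HX F E c N k μ →L[ℂ] HN F E c N k c₁ μZ :=
  (iotaLin hb).mkContinuousOfExistsBound (exists_norm_iotaLin_le hb)

/-- `ι f =ᵐ f ∘ p_c`. [cite: BernsteinLapid2019, §4 Claim 4 p. 10] -/
theorem coeFn_iota (hb : IotaBound F E c N k c₁ μ μZ) (f : HX F E c N k μ) :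
    (iota hb f : borelQuotient F E c N → ℂ) =ᵐ[weightedTruncMeasure F E c N k c₁ μZ] iotaFun F E c N k μ f := by
  rw [show iota hb f = iotaLin hb f from rfl, iotaLin_apply]
  exact (memLp_iotaFun hb f).coeFn_toLp

/-- The Banach isomorphism `𝓗_k(𝔛) ≃L range ι` onto the CLOSED range of the injective `ι` (open mapping theorem, Mathlib `ContinuousLinearEquiv.ofBijective`).
[cite: BernsteinLapid2019, §4 Claim 4 p. 10] -/
def iotaRangeEquiv (hb : IotaBound F E c N k c₁ μ μZ) (hcl : IsClosed ((LinearMap.range (iota hb).toLinearMap : Submodule ℂ (HN F E c N k c₁ μZ)) : Set (HN F E c N k c₁ μZ)))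
    (hinj : Function.Injective (iota hb)) : HX F E c N k μ ≃L[ℂ] LinearMap.range (iota hb).toLinearMap :=
  haveI : CompleteSpace (LinearMap.range (iota hb).toLinearMap) := hcl.completeSpace_coe
  ContinuousLinearEquiv.ofBijective ((iota hb).codRestrict (LinearMap.range (iota hb).toLinearMap) (LinearMap.mem_range_self (iota hb).toLinearMap))
    (LinearMap.ker_eq_bot.2 fun x y hxy => hinj (congrArg Subtype.val hxy))
    (LinearMap.range_eq_top.2 fun y => by obtain ⟨x, hx⟩ := y.2; exact ⟨x, Subtype.ext hx⟩)

/-- `ι (iotaRangeEquiv⁻¹ y) = y`. [cite: BernsteinLapid2019, §4 Claim 4 p. 10] -/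
theorem iota_iotaRangeEquiv_symm (hb : IotaBound F E c N k c₁ μ μZ) (hcl : IsClosed ((LinearMap.range (iota hb).toLinearMap : Submodule ℂ (HN F E c N k c₁ μZ)) : Set (HN F E c N k c₁ μZ)))
    (hinj : Function.Injective (iota hb)) (y : LinearMap.range (iota hb).toLinearMap) :
    iota hb ((iotaRangeEquiv hb hcl hinj).symm y) = (y : HN F E c N k c₁ μZ) :=
  congrArg Subtype.val ((iotaRangeEquiv hb hcl hinj).apply_symm_apply y)

/-- **`π_{c,k} : 𝓗_k(Z_c) →L 𝓗_k(𝔛)`** — defined from the closed-range (`hcl`) and injectivity (`hinj`) letters of Claim 4 bullet 1 as `ι⁻¹ ∘ P_{range ι}` (Banach inverse of `ι` onto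
its closed range after the orthogonal projection onto that range), so that `ι ∘ π = P_{range ι}` (bullet 2) holds by construction. [cite: BernsteinLapid2019, §4 Claim 4 p. 10] -/
def piN (hb : IotaBound F E c N k c₁ μ μZ) (hcl : IsClosed ((LinearMap.range (iota hb).toLinearMap : Submodule ℂ (HN F E c N k c₁ μZ)) : Set (HN F E c N k c₁ μZ)))
    (hinj : Function.Injective (iota hb)) : HN F E c N k c₁ μZ →L[ℂ] HX F E c N k μ :=
  haveI : CompleteSpace (LinearMap.range (iota hb).toLinearMap) := hcl.completeSpace_coe
  ((iotaRangeEquiv hb hcl hinj).symm : LinearMap.range (iota hb).toLinearMap →L[ℂ] HX F E c N k μ).comp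
    (LinearMap.range (iota hb).toLinearMap).orthogonalProjectionOnto

/-- **`ι ∘ π = ` the orthogonal projection onto `range ι`** (Claim 4 bullet 2, by construction). [cite: BernsteinLapid2019, §4 Claim 4 p. 10] -/
theorem iota_piN (hb : IotaBound F E c N k c₁ μ μZ) (hcl : IsClosed ((LinearMap.range (iota hb).toLinearMap : Submodule ℂ (HN F E c N k c₁ μZ)) : Set (HN F E c N k c₁ μZ)))
    (hinj : Function.Injective (iota hb)) (f : HN F E c N k c₁ μZ) :
    haveI : CompleteSpace (LinearMap.range (iota hb).toLinearMap) := hcl.completeSpace_coe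
    iota hb (piN hb hcl hinj f) = ((LinearMap.range (iota hb).toLinearMap).orthogonalProjectionOnto f : HN F E c N k c₁ μZ) :=
  iota_iotaRangeEquiv_symm hb hcl hinj _

end Iota

/-! ## §2 (D7) The shifted Hecke operator `δ_{c,c₀}(h) = restr ∘ R(h)` -/

section Shift

variable [MeasurableSpace (quasiSplit F E c N).Adelic]

/-- **Right convolution on functions on `Z`**: `(R(h)φ)(z) := ∫_{G(𝔸)} h(y)·φ(z·y) dν_G(y)` (Bernstein–Lapid's `δ(h)`, `z·y = rightShift y z`). [cite: BernsteinLapid2019, §4 p. 10] -/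
def rightConvFun (νG : Measure (quasiSplit F E c N).Adelic) (h : (quasiSplit F E c N).Adelic → ℂ) (φ : borelQuotient F E c N → ℂ) : borelQuotient F E c N → ℂ :=
  fun z => ∫ y, h y * φ (rightShift F E c N y z) ∂νG

/-- **THE LETTER `ShiftBound`** (B–L p. 10: for `h` of compact support and `c₀ ≤ κ_h·c`, «`δ(h)` maps functions supported in `Z_c^-` to functions supported in `Z_{c₀}^-`» and is bounded on
the weighted `L²`): there EXISTS a bounded operator `T : 𝓗_k(Z_c) → 𝓗_k(Z_{c₀})` whose value on every class is (a.e.) the right convolution of a representative.  Such `T` is unique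
(`deltaShift_spec` pins it a.e.); P3 `K2E1BLHeckeOperatorWeightedU2` discharges the letter. [cite: BernsteinLapid2019, §4 p. 10] [cite: MoeglinWaldspurger1995, I.2.13] -/
def ShiftBound (k : ℕ) (c₁ c₀ : ℝ≥0) (νG : Measure (quasiSplit F E c N).Adelic) (μZ : Measure (borelQuotient F E c N)) (h : (quasiSplit F E c N).Adelic → ℂ) : Prop :=
  ∃ T : HN F E c N k c₁ μZ →L[ℂ] HN F E c N k c₀ μZ, ∀ f : HN F E c N k c₁ μZ,
    (T f : borelQuotient F E c N → ℂ) =ᵐ[weightedTruncMeasure F E c N k c₀ μZ] rightConvFun F E c N νG h (f : borelQuotient F E c N → ℂ)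

variable {F E c N} {k : ℕ} {c₁ c₀ : ℝ≥0} {νG : Measure (quasiSplit F E c N).Adelic} {μZ : Measure (borelQuotient F E c N)} {h : (quasiSplit F E c N).Adelic → ℂ}

/-- **`δ_{c,c₀}(h) : 𝓗_k(Z_c) →L 𝓗_k(Z_{c₀})`** — THE operator of the letter `ShiftBound`. [cite: BernsteinLapid2019, §4 p. 10] -/
def deltaShift (hs : ShiftBound F E c N k c₁ c₀ νG μZ h) : HN F E c N k c₁ μZ →L[ℂ] HN F E c N k c₀ μZ :=
  Classical.choose hs

/-- `δ_{c,c₀}(h) f =ᵐ R(h) f` on `Z_{c₀}`. [cite: BernsteinLapid2019, §4 p. 10] -/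
theorem deltaShift_spec (hs : ShiftBound F E c N k c₁ c₀ νG μZ h) (f : HN F E c N k c₁ μZ) :
    (deltaShift hs f : borelQuotient F E c N → ℂ) =ᵐ[weightedTruncMeasure F E c N k c₀ μZ] rightConvFun F E c N νG h (f : borelQuotient F E c N → ℂ) :=
  Classical.choose_spec hs f

end Shift

end Summit.HodgeConjecture.HodgeConjecture.Cruxes.H413.K2E1BLBorelOperatorsU2Defs

end
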